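import Summits.SmoothPoincare4.SmoothPoincare4.Theorems.DottedCircleRasmussenDcrGapStubHandlebodyChartRedCore
import Summits.SmoothPoincare4.SmoothPoincare4.Theorems.DottedCircleRasmussenDcrGapHelperHandlebodyChartFacts
import Summits.SmoothPoincare4.SmoothPoincare4.Theorems.DottedCircleRasmussenDcrGapHelperHandlebodyChartNamedFacts
import Literature.Topology.FourManifolds.MMSWRasmussenFacts
import Literature.Topology.FourManifolds.MMSWFibreRotation

/-!
# Stub `stub_handlebodyChart` of line `mk_friends` for crux `DcrGap`: the handle induction and the
# conditional reduction `helper_handlebodyChart_of_facts2`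
(item stmt-SmoothPoincare4-16128, route route-SmoothPoincare4-DottedCircleRasmussen)

**Stub D, closed modulo two Literature facts and one model lemma.**  Stub `stub_handlebodyChart`
says: in a closed simply connected smooth `4`-manifold `X`, every germ chart `i` of the model
dotted handlebody `D_k = MMSW.modelHandlebody k ⊂ ℝ⁴` (smooth, injective and immersive on an
open `U ⊇ D_k`) satisfies `e ∘ τ^ε = i` on `D_k` for some per-handle sphere twist
`τ^ε = MMSW.fibreRot (z ↦ Π_j u_j(z)^{ε_j})` and some GLOBAL smooth embedding `e : ℝ⁴ ↪ X`.
This file proves the registered reduction `helper_handlebodyChart_of_facts2`: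

  (M1) `Literature.Topology.FourManifolds.oneHandle_ambientIsotopic_upToTwist` →
  (M2) `Literature.Topology.FourManifolds.arcs_ambientIsotopic_rel_of_homotopicRel` →
  (M3) the model handle lemma (registered open helper `helper_handlebodyChart_modelHandles`,
       written out literally) → stub D, verbatim.

M1 (Hirsch 1976, Ch. 4 §5 Thm. 5.3 + Ch. 8 §1 Thm. 1.3) and M2 (Whitney 1936 §II Thm. 6, Milnor 1965
Thm. 8.4, Hirsch Ch. 8 §1 Thm. 1.3) are published theorems, filed as named facts
(`OneHandleUniqueness.lean`).  M3 is a statement about OUR explicit model `D_k` (Kirby's dotted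
picture of `B⁴ ∪ k` one-handles): a base ball `B̄(c, 3a/2) ⊆ D_k`, `k` handle charts `h j` (smooth
injective immersions of an open `W ⊇ T` into `D_k`, pairwise disjoint images, entering the ball
conically), and for every open `U ⊇ D_k`, `m : Fin k → ℤ`, `a < ρ < 3a/2`: a twist exponent `ε`, a
diffeomorphism `κ` of `ℝ⁴` supported in a compact `K ⊆ U` squeezing `D_k` into
`B̄(c, ρ) ∪ ⋃ⱼ h j (T)`, and a global smooth injective immersion `θ` with `θ ∘ τ^ε = σ_m ∘ κ` on
`D_k` (`σ_m = id` on the ball, `h j ∘ R_{m j} ∘ (h j)⁻¹` on tube `j`).  It is true model calculus,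
not yet in the tree, and it is what the earlier registered `helper_handlebodyChart_of_facts`
(M1 → M2 → D) needs silently.

Contents: `handlebodyChart_handleInduction` — **step (3) of D**, the handles matched one at a
time by M1 with a geometric sequence of protected balls — and the assembly
`helper_handlebodyChart_of_facts2` (steps (1)–(4); see its docstring).  Everything is proved; the
three hypotheses are the only debts.

References: R. Kirby, *The Topology of 4-Manifolds*, LNM 1374 (1989), Ch. I §2 [Kirby1989];
M. W. Hirsch, *Differential Topology* (1976), Ch. 4 §5, Ch. 8 §1 [HirschDT1976]; H. Whitney,
*Differentiable manifolds* (1936) §II Thm. 6 [Whitney1936]; J. Milnor, *Lectures on the h-cobordism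
theorem* (1965), Thm. 8.4 [MilnorHCobordism1965]; J. M. Lee, *Introduction to Smooth Manifolds*
(2013), Thm. 4.5, Prop. 5.2 [Lee2013].
-/

-- the prescribed namespace `Summit.<P>.<Sub>.…` duplicates `SmoothPoincare4` (P = Sub)
set_option linter.dupNamespace false

noncomputable section

open scoped Manifold ContDiff Topology
open Function Set Metric
open Literature.Topology.FourManifolds

namespace Summit.SmoothPoincare4.SmoothPoincare4.Theorems.DcrGap.MkFriends

/-- Local notation: `𝔼4` is `EuclideanSpace ℝ (Fin 4)`. -/
local notation "𝔼4" => EuclideanSpace ℝ (Fin 4)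

/-! ## Step (3): matching the handles one at a time -/

/-- **The handle induction of stub D.**  Same setting as `handlebodyChart_arcStep`, after the
arc step: a diffeomorphism `Φ₀` with `Φ₀ ∘ i = e₁` on `B̄(c, 4a/3)` and on the `k` core arcs.
Granting the `1`-handle uniqueness fact (hypothesis `hM1`, for the manifold `X` and an abstract
twist family `R m` preserving the cylinder `T` with `R m ∘ R (-m) = id`), the handles are
matched one at a time: at stage `n` the chart `Φ ∘ i` agrees with `e₁` on the ball
`B̄(c, a(1 + 3^{-(n+1)}))`, with `e₁ ∘ h l ∘ R (m l)` on the tubes `h l (T)`, `l < n`, and with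
`e₁` on the cores of the remaining handles; the fact, applied to the tubes `Φ ∘ i ∘ h n` and
`e₁ ∘ h n` with `η = 3^{-(n+1)}` and the closed set
`Z = e₁(B̄(c, a(1 + 3^{-(n+2)}))) ∪ ⋃_{l<n} e₁(h l (T)) ∪ ⋃_{l>n} e₁(core l)` (missed by both
tubes away from their feet: the tubes enter the balls conically and are pairwise disjoint),
supplies the next stage.  Conclusion: some `Φ` and `m : Fin k → ℤ` with `Φ ∘ i = e₁` on
`B̄(c, a(1 + 3^{-(k+1)}))` and `Φ (i (h j p)) = e₁ (h j (R (m j) p))` on `T`. [folklore] -/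
theorem handlebodyChart_handleInduction {X : Type} [TopologicalSpace X] [T2Space X]
    [SecondCountableTopology X] [CompactSpace X] [ChartedSpace 𝔼4 X] [IsManifold (𝓡 4) ∞ X]
    {R : ℤ → 𝔼4 → 𝔼4}
    (hR1 : ∀ m, ∀ p ∈ {p : 𝔼4 | |p 0| ≤ 1 ∧ (p 1) ^ 2 + (p 2) ^ 2 + (p 3) ^ 2 ≤ 1},
      R m p ∈ {p : 𝔼4 | |p 0| ≤ 1 ∧ (p 1) ^ 2 + (p 2) ^ 2 + (p 3) ^ 2 ≤ 1})
    (hR2 : ∀ m p, R m (R (-m) p) = p)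
    (hM1 : ∀ (W : Set 𝔼4) (h₀ h₁ : 𝔼4 → X) (Z : Set X) (η : ℝ), 0 < η → η ≤ 1 → IsOpen W →
      {p : 𝔼4 | |p 0| ≤ 1 ∧ (p 1) ^ 2 + (p 2) ^ 2 + (p 3) ^ 2 ≤ 1} ⊆ W →
      (ContMDiffOn (𝓡 4) (𝓡 4) ∞ h₀ W ∧ InjOn h₀ W ∧
        ∀ p ∈ W, Injective (mfderiv (𝓡 4) (𝓡 4) h₀ p)) →
      (ContMDiffOn (𝓡 4) (𝓡 4) ∞ h₁ W ∧ InjOn h₁ W ∧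
        ∀ p ∈ W, Injective (mfderiv (𝓡 4) (𝓡 4) h₁ p)) →
      (∀ p ∈ W, 1 - η < |p 0| → h₀ p = h₁ p) →
      (∀ t : ℝ, |t| ≤ 1 → h₀ (!₂[t, 0, 0, 0]) = h₁ (!₂[t, 0, 0, 0])) →
      IsClosed Z →
      (∀ p : 𝔼4, |p 0| ≤ 1 - η / 2 → (p 1) ^ 2 + (p 2) ^ 2 + (p 3) ^ 2 ≤ 1 →
        h₀ p ∉ Z ∧ h₁ p ∉ Z) →
      ∃ (m : ℤ) (Φ : X ≃ₘ⟮𝓡 4, 𝓡 4⟯ X), (∀ z ∈ Z, Φ z = z) ∧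
        ∀ p : 𝔼4, |p 0| ≤ 1 → (p 1) ^ 2 + (p 2) ^ 2 + (p 3) ^ 2 ≤ 1 → Φ (h₀ p) = h₁ (R m p))
    {U : Set 𝔼4} (hUo : IsOpen U) {i : 𝔼4 → X}
    (hi : ContMDiffOn (𝓡 4) (𝓡 4) ∞ i U ∧ InjOn i U ∧
      ∀ x ∈ U, Injective (mfderiv (𝓡 4) (𝓡 4) i x))
    {e₁ : 𝔼4 → X} (he : ContMDiff (𝓡 4) (𝓡 4) ∞ e₁ ∧ Injective e₁ ∧
      ∀ x, Injective (mfderiv (𝓡 4) (𝓡 4) e₁ x))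
    {c : 𝔼4} {a : ℝ} (ha : 0 < a) (hcU : closedBall c (3 * a / 2) ⊆ U)
    {k : ℕ} {W : Set 𝔼4} (hWo : IsOpen W)
    (hTW : {p : 𝔼4 | |p 0| ≤ 1 ∧ (p 1) ^ 2 + (p 2) ^ 2 + (p 3) ^ 2 ≤ 1} ⊆ W)
    {h : Fin k → 𝔼4 → 𝔼4}
    (hh : ∀ j, ContDiffOn ℝ ∞ (h j) W ∧ InjOn (h j) W ∧
      (∀ p ∈ W, Injective (fderiv ℝ (h j) p)) ∧ MapsTo (h j) W U)
    (hdisj : ∀ j l, j ≠ l → ∀ p ∈ W, ∀ q ∈ W, h j p ≠ h l q)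
    (hnear : ∀ j, ∀ p ∈ W, 1 / 2 ≤ |p 0| → dist (h j p) c = a * (2 - |p 0|))
    (hfar : ∀ j, ∀ p ∈ W, |p 0| ≤ 1 / 2 → 3 * a / 2 ≤ dist (h j p) c)
    (Φ₀ : X ≃ₘ⟮𝓡 4, 𝓡 4⟯ X)
    (hΦ₀ : (∀ x, dist x c ≤ 4 * a / 3 → Φ₀ (i x) = e₁ x) ∧
      ∀ j, ∀ t : ℝ, |t| ≤ 1 → Φ₀ (i (h j !₂[t, 0, 0, 0])) = e₁ (h j !₂[t, 0, 0, 0])) :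
    ∃ (Φ : X ≃ₘ⟮𝓡 4, 𝓡 4⟯ X) (m : Fin k → ℤ),
      (∀ x, dist x c ≤ a * (1 + (1 / 3) ^ (k + 1)) → Φ (i x) = e₁ x) ∧
      ∀ j, ∀ p ∈ {p : 𝔼4 | |p 0| ≤ 1 ∧ (p 1) ^ 2 + (p 2) ^ 2 + (p 3) ^ 2 ≤ 1},
        Φ (i (h j p)) = e₁ (h j (R (m j) p)) := by
  obtain ⟨hLs, hLinj, hLd, hLc⟩ := helper_handlebodyChart_coreLine
  set T : Set 𝔼4 := {p : 𝔼4 | |p 0| ≤ 1 ∧ (p 1) ^ 2 + (p 2) ^ 2 + (p 3) ^ 2 ≤ 1} with hT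
  set L : ℝ → 𝔼4 := fun t => !₂[t, 0, 0, 0] with hL
  have hL0 : ∀ t, (L t) 0 = t := fun t => (hLc t).1
  have hLT : ∀ t, |t| ≤ 1 → L t ∈ T :=
    fun t ht => ⟨by rw [hL0]; exact ht, by rw [(hLc t).2.1, (hLc t).2.2.1, (hLc t).2.2.2]; norm_num⟩
  have hTc : IsCompact T := helper_handlebodyChart_isCompactCylinder
  have hWU : ∀ j, ∀ p ∈ W, h j p ∈ U := fun j p hp => (hh j).2.2.2 hp
  have hTU : ∀ j, ∀ p ∈ T, h j p ∈ U := fun j p hp => hWU j p (hTW hp)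
  -- germ-chart data of `e₁` and of the tubes `e₁ ∘ h j`
  have he' : ContMDiffOn (𝓡 4) (𝓡 4) ∞ e₁ univ ∧ InjOn e₁ univ ∧
      ∀ x ∈ univ, Injective (mfderiv (𝓡 4) (𝓡 4) e₁ x) :=
    ⟨he.1.contMDiffOn, he.2.1.injOn, fun x _ => he.2.2 x⟩
  have ht₁ : ∀ j, ContMDiffOn (𝓡 4) (𝓡 4) ∞ (e₁ ∘ h j) W ∧ InjOn (e₁ ∘ h j) W ∧
      ∀ p ∈ W, Injective (mfderiv (𝓡 4) (𝓡 4) (e₁ ∘ h j) p) := fun j =>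
    handlebodyChart_germ_comp isOpen_univ he' hWo (hh j).1 (hh j).2.1 (hh j).2.2.1
      (mapsTo_univ _ _)
  -- the radii `ρ n = a (1 + 3^{-(n+1)})`
  set ρ : ℕ → ℝ := fun n => a * (1 + (1 / 3) ^ (n + 1)) with hρ
  have hpow_le : ∀ n : ℕ, ((1 : ℝ) / 3) ^ (n + 1) ≤ 1 / 3 := fun n => by
    calc ((1 : ℝ) / 3) ^ (n + 1) = (1 / 3) ^ n * (1 / 3) := pow_succ _ _
      _ ≤ 1 * (1 / 3) := by
          gcongr
          exact pow_le_one₀ (by norm_num) (by norm_num)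
      _ = 1 / 3 := one_mul _
  have hpow_pos : ∀ n : ℕ, (0 : ℝ) < (1 / 3) ^ (n + 1) := fun n => by positivity
  have hρ_succ : ∀ n, ρ (n + 1) ≤ ρ n := fun n => by
    simp only [hρ]
    have : ((1 : ℝ) / 3) ^ (n + 1 + 1) ≤ (1 / 3) ^ (n + 1) :=
      pow_le_pow_of_le_one (by norm_num) (by norm_num) (by omega)
    nlinarith
  have hρ_le : ∀ n, ρ n ≤ 3 * a / 2 := fun n => by
    simp only [hρ]; nlinarith [hpow_le n]
  -- the invariant
  have key : ∀ n, n ≤ k → ∃ (Φ : X ≃ₘ⟮𝓡 4, 𝓡 4⟯ X) (m : Fin k → ℤ),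
      (∀ x, dist x c ≤ ρ n → Φ (i x) = e₁ x) ∧
      (∀ l : Fin k, (l : ℕ) < n → ∀ p ∈ T, Φ (i (h l p)) = e₁ (h l (R (m l) p))) ∧
      (∀ l : Fin k, n ≤ (l : ℕ) → ∀ t : ℝ, |t| ≤ 1 → Φ (i (h l (L t))) = e₁ (h l (L t))) := by
    intro n
    induction n with
    | zero =>
      intro _
      refine ⟨Φ₀, fun _ => 0, fun x hx => hΦ₀.1 x ?_, fun l hl => absurd hl (Nat.not_lt_zero _),
        fun l _ t ht => hΦ₀.2 l t ht⟩
      have : ρ 0 = 4 * a / 3 := by simp only [hρ]; ring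
      linarith
    | succ n ih =>
      intro hn1
      obtain ⟨Φ, m, h1, h2, h3⟩ := ih (Nat.le_of_succ_le hn1)
      have hnk : n < k := hn1
      set j : Fin k := ⟨n, hnk⟩ with hj
      -- the parameter `η = 3^{-(n+1)}`
      set η : ℝ := (1 / 3) ^ (n + 1) with hη
      have hη0 : 0 < η := hpow_pos n
      have hη3 : η ≤ 1 / 3 := hpow_le n
      have hη1 : η ≤ 1 := hη3.trans (by norm_num)
      have hρn : ρ n = a * (1 + η) := rfl
      have hρn1 : ρ (n + 1) = a * (1 + η / 3) := by
        simp only [hρ, hη]; ring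
      -- the two tubes
      obtain ⟨hg1, hg2, hg3⟩ := handlebodyChart_germ_comp_diffeomorph hUo hi.1 hi.2.1 hi.2.2 Φ
      have ht₀ : ContMDiffOn (𝓡 4) (𝓡 4) ∞ ((Φ ∘ i) ∘ h j) W ∧ InjOn ((Φ ∘ i) ∘ h j) W ∧
          ∀ p ∈ W, Injective (mfderiv (𝓡 4) (𝓡 4) ((Φ ∘ i) ∘ h j) p) :=
        handlebodyChart_germ_comp hUo ⟨hg1, hg2, hg3⟩ hWo (hh j).1 (hh j).2.1 (hh j).2.2.1
          (hh j).2.2.2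
      -- the protected closed set
      set Z : Set X := e₁ '' closedBall c (ρ (n + 1)) ∪
        ((⋃ l ∈ {l : Fin k | (l : ℕ) < n}, e₁ '' (h l '' T)) ∪
          ⋃ l ∈ {l : Fin k | n < (l : ℕ)}, e₁ '' ((fun t => h l (L t)) '' Icc (-1 : ℝ) 1)) with hZ
      have hZc : IsClosed Z := by
        refine ((isCompact_closedBall c _).image he.1.continuous).isClosed.union
          (IsClosed.union ?_ ?_)
        · refine (Set.toFinite _).isClosed_biUnion fun l _ => ?_
          exact ((hTc.image_of_continuousOn ((hh l).1.continuousOn.mono hTW)).image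
            he.1.continuous).isClosed
        · refine (Set.toFinite _).isClosed_biUnion fun l _ => ?_
          refine ((isCompact_Icc.image_of_continuousOn ?_).image he.1.continuous).isClosed
          exact (hh l).1.continuousOn.comp hLs.continuous.continuousOn
            fun t ht => hTW (hLT t (abs_le.2 ht))
      -- distances of tube points from the centre
      have hdist_out : ∀ p ∈ T, |p 0| ≤ 1 - η / 2 → ρ (n + 1) < dist (h j p) c := by
        intro p hp hp0
        rw [hρn1]
        rcases le_or_gt (1 / 2) |p 0| with h12 | h12
        · rw [hnear j p (hTW hp) h12]; nlinarith
        · have := hfar j p (hTW hp) h12.le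
          have : η / 3 < 1 / 2 := by linarith [hη3]
          nlinarith
      have hdist_in : ∀ p ∈ W, 1 - η < |p 0| → dist (h j p) c ≤ ρ n := by
        intro p hp hp0
        have h12 : 1 / 2 ≤ |p 0| := by linarith [hη3]
        rw [hnear j p hp h12, hρn]; nlinarith
      -- hypotheses of the fact
      have hagreeW : ∀ p ∈ W, 1 - η < |p 0| → ((Φ ∘ i) ∘ h j) p = (e₁ ∘ h j) p :=
        fun p hp hp0 => h1 _ (hdist_in p hp hp0)
      have hcore : ∀ t : ℝ, |t| ≤ 1 → ((Φ ∘ i) ∘ h j) (!₂[t, 0, 0, 0]) = (e₁ ∘ h j) (!₂[t, 0, 0, 0]) :=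
        fun t ht => h3 j le_rfl t ht
      have hoff : ∀ p : 𝔼4, |p 0| ≤ 1 - η / 2 → (p 1) ^ 2 + (p 2) ^ 2 + (p 3) ^ 2 ≤ 1 →
          ((Φ ∘ i) ∘ h j) p ∉ Z ∧ (e₁ ∘ h j) p ∉ Z := by
        intro p hp0 hpf
        have hpT : p ∈ T := ⟨hp0.trans (by linarith), hpf⟩
        have hpW : p ∈ W := hTW hpT
        have hd := hdist_out p hpT hp0
        -- `h j p` is not a point of the protected ball, of an earlier tube, or of a later core
        have hnot_ball : h j p ∉ closedBall c (ρ (n + 1)) := fun hb =>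
          absurd (mem_closedBall.1 hb) (not_le.2 hd)
        have hnot_tube : ∀ l : Fin k, (l : ℕ) < n → ∀ q ∈ T, h j p ≠ h l q := fun l hl q hq =>
          hdisj j l (fun hjl => absurd (congrArg Fin.val hjl) (by rw [hj]; exact hl.ne')) p hpW q (hTW hq)
        have hnot_core : ∀ l : Fin k, n < (l : ℕ) → ∀ t ∈ Icc (-1 : ℝ) 1, h j p ≠ h l (L t) :=
          fun l hl t ht => hdisj j l (fun hjl => absurd (congrArg Fin.val hjl) (by rw [hj]; exact hl.ne))
            p hpW (L t) (hTW (hLT t (abs_le.2 ht)))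
        constructor
        · -- the tube `Φ ∘ i ∘ h j`
          rintro (⟨s, hs, hse⟩ | hw | hw)
          · have hs' : dist s c ≤ ρ n := (mem_closedBall.1 hs).trans (hρ_succ n)
            rw [← h1 s hs'] at hse
            have : s = h j p := hi.2.1 (hcU (mem_closedBall.2 (hs'.trans (hρ_le n)))) (hTU j p hpT)
              (Φ.injective hse)
            exact hnot_ball (this ▸ hs)
          · obtain ⟨l, hl, hw⟩ := mem_iUnion₂.1 hw
            obtain ⟨q, ⟨q', hq', rfl⟩, hqe⟩ := hw
            have hq'' : R (-(m l)) q' ∈ T := hR1 _ _ hq'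
            have h2' := h2 l hl (R (-(m l)) q') hq''
            rw [hR2] at h2'
            rw [← h2'] at hqe
            have : h l (R (-(m l)) q') = h j p :=
              hi.2.1 (hTU l _ hq'') (hTU j p hpT) (Φ.injective hqe)
            exact hnot_tube l hl _ hq'' this.symm
          · obtain ⟨l, hl, hw⟩ := mem_iUnion₂.1 hw
            obtain ⟨q, ⟨t, ht, rfl⟩, hqe⟩ := hw
            rw [← h3 l (le_of_lt hl) t (abs_le.2 ht)] at hqe
            have : h l (L t) = h j p :=
              hi.2.1 (hTU l _ (hLT t (abs_le.2 ht))) (hTU j p hpT) (Φ.injective hqe)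
            exact hnot_core l hl t ht this.symm
        · -- the tube `e₁ ∘ h j`
          rintro (⟨s, hs, hse⟩ | hw | hw)
          · exact hnot_ball (he.2.1 hse ▸ hs)
          · obtain ⟨l, hl, hw⟩ := mem_iUnion₂.1 hw
            obtain ⟨q, ⟨q', hq', rfl⟩, hqe⟩ := hw
            exact hnot_tube l hl q' hq' (he.2.1 hqe).symm
          · obtain ⟨l, hl, hw⟩ := mem_iUnion₂.1 hw
            obtain ⟨q, ⟨t, ht, rfl⟩, hqe⟩ := hw
            exact hnot_core l hl t ht (he.2.1 hqe).symm
      -- apply the fact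
      obtain ⟨mj, Φ₃, hfix, hconj⟩ := hM1 W ((Φ ∘ i) ∘ h j) (e₁ ∘ h j) Z η hη0 hη1 hWo hTW ht₀ (ht₁ j)
        hagreeW hcore hZc hoff
      refine ⟨Φ.trans Φ₃, Function.update m j mj, fun x hx => ?_, fun l hl p hp => ?_, fun l hl t ht => ?_⟩
      · -- the smaller ball is protected
        rw [Diffeomorph.coe_trans, comp_apply, h1 x (hx.trans (hρ_succ n))]
        exact hfix _ (Or.inl ⟨x, mem_closedBall.2 hx, rfl⟩)
      · rw [Diffeomorph.coe_trans, comp_apply]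
        rcases (Nat.lt_succ_iff_lt_or_eq).1 hl with hl' | hl'
        · -- an earlier tube: protected
          have hlj : l ≠ j := fun hlj => absurd (congrArg Fin.val hlj) (by rw [hj]; exact hl'.ne)
          rw [Function.update_of_ne hlj, h2 l hl' p hp]
          exact hfix _ (Or.inr (Or.inl (mem_iUnion₂.2 ⟨l, hl', h l (R (m l) p), ⟨R (m l) p, hR1 _ _ hp, rfl⟩, rfl⟩)))
        · -- the new tube: the fact's conclusion
          have hlj : l = j := Fin.ext (by rw [hj]; exact hl')
          subst hlj
          rw [Function.update_self]
          exact hconj p hp.1 hp.2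
      · -- a later core: protected
        rw [Diffeomorph.coe_trans, comp_apply, h3 l (Nat.le_of_succ_le hl) t ht]
        have hl' : n < (l : ℕ) := hl
        exact hfix _ (Or.inr (Or.inr (mem_iUnion₂.2 ⟨l, hl', h l (L t), ⟨t, abs_le.1 ht, rfl⟩, rfl⟩)))
  obtain ⟨Φ, m, h1, h2, -⟩ := key k le_rfl
  exact ⟨Φ, m, h1, fun j p hp => h2 j j.2 p hp⟩

/-! ## Step (4): the assembly -/

/-- **Registered reduction `helper_handlebodyChart_of_facts2`: stub D from the two Literature
facts and the model handle lemma.**  Hypotheses: (M1) `oneHandle_ambientIsotopic_upToTwist`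
(uniqueness of `1`-handles up to the fibre twist, Hirsch 1976 Ch. 4 §5 Thm. 5.3 + Ch. 8 §1
Thm. 1.3); (M2) `arcs_ambientIsotopic_rel_of_homotopicRel` (arcs homotopic rel ends are ambient
isotopic rel ends and rel a closed set, Whitney 1936 / Milnor 1965 Thm. 8.4 / Hirsch Ch. 8 §1
Thm. 1.3); (M3) the MODEL HANDLE LEMMA `helper_handlebodyChart_modelHandles` about the explicit
model `D_k = MMSW.modelHandlebody k` (stated literally as the third hypothesis): a base ball
`B̄(c, 3a/2) ⊆ D_k` and `k` handle charts `h j` — smooth injective immersions of an open `W ⊇ T`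
(`T` the solid cylinder `{|p₀| ≤ 1, p₁² + p₂² + p₃² ≤ 1}`) into `D_k` with pairwise disjoint
images, entering the ball conically (`dist (h j p, c) = a (2 - |p₀|)` for `|p₀| ≥ 1/2`, `≥ 3a/2`
for `|p₀| ≤ 1/2`) — together with, for every open `U ⊇ D_k`, every twist vector
`m : Fin k → ℤ` and every radius `a < ρ < 3a/2`, a twist exponent `ε`, a diffeomorphism `κ` of
`ℝ⁴` supported in a compact `K ⊆ U` squeezing `D_k` into `B̄(c, ρ) ∪ ⋃ⱼ h j (T)`, and a global
smooth injective immersion `θ` of `ℝ⁴` with `θ ∘ τ^ε = σ_m ∘ κ` on `D_k`, where `σ_m` is the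
identity on the ball and the handle twist `h j ∘ R_{m j} ∘ (h j)⁻¹` on the `j`-th tube.
Conclusion: the registered signature of stub `stub_handlebodyChart`.

Proof (the assembly of D): (1) `e₁ = i ∘ ψ` with `ψ` the ellipsoid stretch fixing `B̄(c, 3a/2)`
(`helper_handlebodyChart_ellipsoidStretch`, `helper_handlebodyChart_chartData`) is a global
chart agreeing with `i` on the ball; (2) the arc step (`handlebodyChart_arcStep`, fact M2)
produces `Φ₀` with `Φ₀ ∘ i = e₁` on `B̄(c, 4a/3)` and on the cores; (3) the handle induction
(`handlebodyChart_handleInduction`, fact M1) produces `Φ` and `m` with `Φ ∘ i = e₁` on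
`B̄(c, ρ_k)`, `ρ_k = a(1 + 3^{-(k+1)})`, and `Φ ∘ i ∘ h j = e₁ ∘ h j ∘ R_{m j}` on `T`; (4) M3 with
`U`, `m`, `ρ_k` gives `ε, κ, θ`; the squeeze `κ` is transported through the germ chart `Φ ∘ i`
to a diffeomorphism `Ξ` of `X` (`handlebodyChart_transport`), and
`e := Φ⁻¹ ∘ Ξ⁻¹ ∘ e₁ ∘ θ` is a smooth embedding (`helper_handlebodyChart_chartData` for
`i ∘ (ψ ∘ θ)`, then `Manifold.IsSmoothEmbedding.diffeomorph_comp`) with `e ∘ τ^ε = i` on `D_k`: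
for `x ∈ D_k`, `Ξ (Φ (i x)) = Φ (i (κ x))` equals `e₁ (κ x) = e₁ (θ (τ^ε x))` if `κ x` lies in the
ball, and `e₁ (h j (R_{m j} p)) = e₁ (θ (τ^ε x))` if `κ x = h j p`. [folklore] -/
theorem helper_handlebodyChart_of_facts2 : Literature.Topology.FourManifolds.oneHandle_ambientIsotopic_upToTwist → Literature.Topology.FourManifolds.arcs_ambientIsotopic_rel_of_homotopicRel → (∀ (k : ℕ), ∃ (c : EuclideanSpace ℝ (Fin 4)) (a : ℝ) (W : Set (EuclideanSpace ℝ (Fin 4))) (h : Fin k → EuclideanSpace ℝ (Fin 4) → EuclideanSpace ℝ (Fin 4)), 0 < a ∧ Metric.closedBall c (3 * a / 2) ⊆ Literature.Topology.FourManifolds.MMSW.modelHandlebody k ∧ IsOpen W ∧ {p : EuclideanSpace ℝ (Fin 4) | |p 0| ≤ 1 ∧ (p 1) ^ 2 + (p 2) ^ 2 + (p 3) ^ 2 ≤ 1} ⊆ W ∧ (∀ j, ContDiffOn ℝ ((⊤ : ℕ∞) : WithTop ℕ∞) (h j) W ∧ Set.InjOn (h j) W ∧ (∀ p ∈ W, Function.Injective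 (fderiv ℝ (h j) p)) ∧ Set.MapsTo (h j) W (Literature.Topology.FourManifolds.MMSW.modelHandlebody k)) ∧ (∀ j l, j ≠ l → ∀ p ∈ W, ∀ q ∈ W, h j p ≠ h l q) ∧ (∀ j, ∀ p ∈ W, 1 / 2 ≤ |p 0| → dist (h j p) c = a * (2 - |p 0|)) ∧ (∀ j, ∀ p ∈ W, |p 0| ≤ 1 / 2 → 3 * a / 2 ≤ dist (h j p) c) ∧ ∀ (U : Set (EuclideanSpace ℝ (Fin 4))) (m : Fin k → ℤ) (ρ : ℝ), IsOpen U → Literature.Topology.FourManifolds.MMSW.modelHandlebody k ⊆ U → a < ρ → ρ < 3 * a / 2 → ∃ (ε : Fin k → ℤ) (κ : EuclideanSpace ℝ (Fin 4) ≃ₘ⟮𝓡 4, 𝓡 4⟯ EuclideanSpace ℝ (Fin 4)) (K : Set (EuclideanSpace ℝ (Fin 4))) (θ : EuclideanSpace ℝ (Fin 4) → EuclideanSpace ℝ (Fin 4)), IsCompact K ∧ K ⊆ U ∧ (∀ x, x ∉ K → κ x = x) ∧ ContDiff ℝ ((⊤ : ℕ∞) : WithTop ℕ∞) θ ∧ Function.Injective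 θ ∧ (∀ x, Function.Injective (fderiv ℝ θ x)) ∧ ∀ x ∈ Literature.Topology.FourManifolds.MMSW.modelHandlebody k, (κ x ∈ Metric.closedBall c ρ ∧ θ (Literature.Topology.FourManifolds.MMSW.fibreRot (fun z : ℂ => ∏ l : Fin k, ((z - Literature.Topology.FourManifolds.MMSW.holeCentre k l) / (((‖z - Literature.Topology.FourManifolds.MMSW.holeCentre k l‖ : ℝ)) : ℂ)) ^ (ε l)) x) = κ x) ∨ (∃ j, ∃ p ∈ {p : EuclideanSpace ℝ (Fin 4) | |p 0| ≤ 1 ∧ (p 1) ^ 2 + (p 2) ^ 2 + (p 3) ^ 2 ≤ 1}, κ x = h j p ∧ θ (Literature.Topology.FourManifolds.MMSW.fibreRot (fun z : ℂ => ∏ l : Fin k, ((z - Literature.Topology.FourManifolds.MMSW.holeCentre k l) / (((‖z - Literature.Topology.FourManifolds.MMSW.holeCentre k l‖ : ℝ)) : ℂ)) ^ (ε l)) x) = h j (!₂[p 0, p 1, Real.cos (2 * Real.pi * (m j : ℝ) * Real.smoothTransition (p 0 + 1 / 2)) * p 2 - Real.sin (2 * Real.pi * (m j : ℝ) * Real.smoothTransition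 (p 0 + 1 / 2)) * p 3, Real.sin (2 * Real.pi * (m j : ℝ) * Real.smoothTransition (p 0 + 1 / 2)) * p 2 + Real.cos (2 * Real.pi * (m j : ℝ) * Real.smoothTransition (p 0 + 1 / 2)) * p 3]))) → ∀ (k : ℕ) (X : Type) [TopologicalSpace X] [T2Space X] [SecondCountableTopology X] [ChartedSpace (EuclideanSpace ℝ (Fin 4)) X] [IsManifold (𝓡 4) ((⊤ : ℕ∞) : WithTop ℕ∞) X] [CompactSpace X], SimplyConnectedSpace X → ∀ (U : Set (EuclideanSpace ℝ (Fin 4))) (i : EuclideanSpace ℝ (Fin 4) → X), (IsOpen U ∧ Literature.Topology.FourManifolds.MMSW.modelHandlebody k ⊆ U ∧ ContMDiffOn (𝓡 4) (𝓡 4) ((⊤ : ℕ∞) : WithTop ℕ∞) i U ∧ Set.InjOn i U ∧ (∀ x ∈ U, Function.Injective (mfderiv (𝓡 4) (𝓡 4) i x))) → ∃ (ε : Fin k → ℤ) (e : EuclideanSpace ℝ (Fin 4) → X), Manifold.IsSmoothEmbedding (𝓡 4) (𝓡 4) ((⊤ : ℕ∞) : WithTop ℕ∞) e ∧ ∀ x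 ∈ Literature.Topology.FourManifolds.MMSW.modelHandlebody k, e (Literature.Topology.FourManifolds.MMSW.fibreRot (fun z : ℂ => ∏ j : Fin k, ((z - Literature.Topology.FourManifolds.MMSW.holeCentre k j) / (((‖z - Literature.Topology.FourManifolds.MMSW.holeCentre k j‖ : ℝ)) : ℂ)) ^ (ε j)) x) = i x := by
  intro hM1 hM2 hM3 k X _ _ _ _ _ _ hsc U i hyp
  obtain ⟨hUo, hDU, hism, hiinj, hid⟩ := hyp
  haveI := hsc
  obtain ⟨c, a, W, h, ha, hcD, hWo, hTW, hh, hdisj, hnear, hfar, hdyn⟩ := hM3 k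
  have hi : ContMDiffOn (𝓡 4) (𝓡 4) ∞ i U ∧ InjOn i U ∧
      ∀ x ∈ U, Injective (mfderiv (𝓡 4) (𝓡 4) i x) := ⟨hism, hiinj, hid⟩
  have hcU : closedBall c (3 * a / 2) ⊆ U := hcD.trans hDU
  have hh' : ∀ j, ContDiffOn ℝ ∞ (h j) W ∧ InjOn (h j) W ∧
      (∀ p ∈ W, Injective (fderiv ℝ (h j) p)) ∧ MapsTo (h j) W U := fun j =>
    ⟨(hh j).1, (hh j).2.1, (hh j).2.2.1, (hh j).2.2.2.mono_right hDU⟩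
  -- Step (1): the base chart `e₁ = i ∘ ψ`
  have h3a : (0 : ℝ) < 3 * a / 2 := by positivity
  set A : 𝔼4 ≃L[ℝ] 𝔼4 := LinearEquiv.toContinuousLinearEquiv
    (LinearEquiv.smulOfNeZero ℝ 𝔼4 (2 / (3 * a)) (by positivity)) with hA
  have hAx : ∀ x, A x = (2 / (3 * a)) • x := fun x => rfl
  have hAball : ∀ x, ‖A (x - c)‖ ≤ 1 ↔ dist x c ≤ 3 * a / 2 := fun x => by
    rw [hAx, norm_smul, Real.norm_of_nonneg (by positivity), dist_eq_norm, div_mul_eq_mul_div,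
      div_le_one (by positivity)]
    constructor <;> intro h <;> linarith
  obtain ⟨ψ, hψs, hψinj, hψd, hψU, hψid⟩ := helper_handlebodyChart_ellipsoidStretch A c U hUo
    (fun x hx => hcU (mem_closedBall.2 ((hAball x).1 hx)))
  have hψfix : ∀ x, dist x c ≤ 3 * a / 2 → ψ x = x := fun x hx => hψid x ((hAball x).2 hx)
  obtain ⟨-, hEo, hEs, hEd⟩ := helper_handlebodyChart_chartData X U i ψ ⟨hUo, hism, hiinj, hid⟩
    hψs hψinj hψd hψU
  have he : ContMDiff (𝓡 4) (𝓡 4) ∞ (i ∘ ψ) ∧ Injective (i ∘ ψ) ∧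
      ∀ x, Injective (mfderiv (𝓡 4) (𝓡 4) (i ∘ ψ) x) := ⟨hEs, hEo.injective, hEd⟩
  have hagree : ∀ x, dist x c ≤ 3 * a / 2 → (i ∘ ψ) x = i x := fun x hx => by
    show i (ψ x) = i x
    rw [hψfix x hx]
  -- Step (2): the arc step
  obtain ⟨Φ₀, hΦ₀⟩ := handlebodyChart_arcStep hM2 hUo hi he hEo ha hcU hagree hWo hTW hh' hdisj
    hnear hfar
  -- Step (3): the handle induction
  obtain ⟨Φ, m, hΦ1, hΦ2⟩ := handlebodyChart_handleInduction
    (R := fun (m : ℤ) (p : 𝔼4) => (!₂[p 0, p 1,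
      Real.cos (2 * Real.pi * (m : ℝ) * Real.smoothTransition (p 0 + 1 / 2)) * p 2 -
        Real.sin (2 * Real.pi * (m : ℝ) * Real.smoothTransition (p 0 + 1 / 2)) * p 3,
      Real.sin (2 * Real.pi * (m : ℝ) * Real.smoothTransition (p 0 + 1 / 2)) * p 2 +
        Real.cos (2 * Real.pi * (m : ℝ) * Real.smoothTransition (p 0 + 1 / 2)) * p 3] : 𝔼4))
    (fun m' p hp => handlebodyChart_rot_mem _ hp) (fun m' p => handlebodyChart_rot_rot_neg m' p)
    (hM1 X) hUo hi he ha hcU hWo hTW hh' hdisj hnear hfar Φ₀ hΦ₀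
  -- Step (4): the model squeeze and extension, transported through the chart `Φ ∘ i`
  have hpow_le : ((1 : ℝ) / 3) ^ (k + 1) ≤ 1 / 3 := by
    calc ((1 : ℝ) / 3) ^ (k + 1) = (1 / 3) ^ k * (1 / 3) := pow_succ _ _
      _ ≤ 1 * (1 / 3) := by
          gcongr
          exact pow_le_one₀ (by norm_num) (by norm_num)
      _ = 1 / 3 := one_mul _
  have hpow_pos : (0 : ℝ) < (1 / 3) ^ (k + 1) := by positivity
  have hρ1 : a < a * (1 + (1 / 3) ^ (k + 1)) := by nlinarith
  have hρ2 : a * (1 + (1 / 3) ^ (k + 1)) < 3 * a / 2 := by nlinarith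
  obtain ⟨ε, κ, K, θ, hKc, hKU, hκ, hθs, hθinj, hθd, hcase⟩ :=
    hdyn U m (a * (1 + (1 / 3) ^ (k + 1))) hUo hDU hρ1 hρ2
  obtain ⟨hgs, hginj, hgd⟩ := handlebodyChart_germ_comp_diffeomorph hUo hism hiinj hid Φ
  obtain ⟨Ξ, hΞ⟩ := handlebodyChart_transport hUo hgs hginj hgd κ hKc hKU hκ
  -- the embedding `e = Φ⁻¹ ∘ Ξ⁻¹ ∘ i ∘ ψ ∘ θ`
  have hn : (∞ : WithTop ℕ∞) ≠ 0 := by simp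
  have hψθd : ∀ x, Injective (fderiv ℝ (ψ ∘ θ) x) := fun x => by
    rw [fderiv_comp x ((hψs.differentiable hn) _) ((hθs.differentiable hn) _)]
    exact (hψd _).comp (hθd x)
  obtain ⟨hemb, -, -, -⟩ := helper_handlebodyChart_chartData X U i (ψ ∘ θ) ⟨hUo, hism, hiinj, hid⟩
    (hψs.comp hθs) (hψinj.comp hθinj) hψθd (fun x => hψU _)
  refine ⟨ε, fun y => Φ.symm (Ξ.symm (i (ψ (θ y)))),
    (hemb.diffeomorph_comp Ξ.symm).diffeomorph_comp Φ.symm, fun x hx => ?_⟩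
  -- the identity `e ∘ τ^ε = i` on `D_k`
  change Φ.symm (Ξ.symm (i (ψ (θ _)))) = i x
  suffices hkey : i (ψ (θ (Literature.Topology.FourManifolds.MMSW.fibreRot
      (fun z : ℂ => ∏ j : Fin k, ((z - Literature.Topology.FourManifolds.MMSW.holeCentre k j) /
        (((‖z - Literature.Topology.FourManifolds.MMSW.holeCentre k j‖ : ℝ)) : ℂ)) ^ (ε j)) x))) =
      Ξ (Φ (i x)) by
    rw [hkey, Diffeomorph.symm_apply_apply, Diffeomorph.symm_apply_apply]
  have hΞx : Ξ (Φ (i x)) = Φ (i (κ x)) := hΞ x (hDU hx)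
  rw [hΞx]
  rcases hcase x hx with ⟨hball, hθx⟩ | ⟨j, p, hpT, hκx, hθx⟩
  · rw [hθx]
    have hd : dist (κ x) c ≤ 3 * a / 2 := (mem_closedBall.1 hball).trans hρ2.le
    rw [hΦ1 _ (mem_closedBall.1 hball)]
    rfl
  · rw [hθx, hκx, hΦ2 j p hpT]
    rfl

end Summit.SmoothPoincare4.SmoothPoincare4.Theorems.DcrGap.MkFriends

end
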